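import Summits.BirchSwinnertonDyer.BirchSwinnertonDyer.Theorems.UniversalToricDescentWildSplitWaldspurgerManinDisplay
import HarnessLib

/-!
# K1 / UTD shared currency: the LZZ road at an ADDITIVE prime for EVERY Heegner field with `p ∤ w_K` (part 1 of «H2 at
# every additive prime»): the BDP display is EXACTLY `𝓛(χ)·C⁻¹·r(σ𝔭)^{−a}` and tends to `u·(log_{ω_E} P / c)²`, `‖u‖ = 1`,
# Manin constant kept — the sibling of `…WildSplitWaldspurgerManinDisplay` with `d_K < −4` replaced by `p ∤ #𝓞_K^×`

Prover seat `bsd-potss-kmc` (g19), 2026-08-27. HONEST FRAMING: THEOREMS ONLY (0 definitions, 0 named facts, 0 `sorry`),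
CONDITIONAL on the refereed input `LiuZhangZhang2018.thm151_thm153_modularCurve_heegnerVector_additive` (Duke Math. J.
167 (2018) Thm 1.5.1 ∧ 1.5.3 at `p² ∣ N`, p518041). WHY: route `SchneiderFreeAdditiveX3` (K1, cell bsd-schneider) types its
analytic half H2 `SchneiderFree.BranchBDPValueLeAt W p` over Heegner fields with the binders `Odd d_K` and `p ∤ #𝓞_K^×` —
at `p ≥ 5` this ALLOWS `K = ℚ(√−3)` (`w_K = 6`), which the UTD file's binder `d_K < −4` excludes. This file re-runs the
Manin-robust factor ledger with `w_K` symbolic (`manin_unit_identity` already is): the unit becomes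
`u = ι⁻¹(8/(s·w_K²·√|d_K|))`, of norm one as soon as `p ∤ 2·w_K·d_K`. Part 2
(`Theorems/SchneiderFreeAdditiveX3BranchBDPValueOfLZZ.lean`) transfers it to every ♭-frame and every `R₀`-frame and
DISCHARGES H2 at every additive prime modulo the LZZ input.

* `exists_exactDisplay_tors`, `exists_continuousDisplay_tors` — as `exists_exactDisplay_manin` / `…continuousDisplay_manin`
  with `(hd4 : d_K < −4)` replaced by `(hpw : ¬ p ∣ Units.torsionOrder K)`.

References: [LiuZhangZhang2018] Duke Math. J. 167 (2018) Thm 1.5.1, Remark 1.1.2, Thm 1.5.3; [Washington1997] Thm 4.9 (class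
number formula with `w_K`); [EdixhovenManin1991] §1.
-/

set_option autoImplicit false

-- D-0017 layout: summit = sub-problem, so `Summit.BirchSwinnertonDyer.BirchSwinnertonDyer.…` is the
-- mandated namespace of Theorems files (same option as the route's sibling Theorems files).
set_option linter.dupNamespace false

noncomputable section

open scoped Classical MatrixGroups ModularForm Topology NumberField

namespace Summit.BirchSwinnertonDyer.BirchSwinnertonDyer.Theorems.UniversalToricDescentWaldspurgerFlat

open Filter CongruenceSubgroup WeierstrassCurve NumberField IsDedekindDomain Field PowerSeries
  Literature.NumberTheory.EllipticCurves Literature.NumberTheory.EllipticCurves.ModularForms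
  Literature.NumberTheory.EllipticCurves.LiuZhangZhang2018 Literature.NumberTheory.EllipticCurves.Rank1Residual
  Literature.NumberTheory.GaloisRepresentations
  Summit.BirchSwinnertonDyer.Rank1Residual Summit.BirchSwinnertonDyer.Rank1Residual.X11b
  Summit.BirchSwinnertonDyer.Rank1Residual.X11b.Halves Summit.BirchSwinnertonDyer.Rank1Residual.X2
  BiquadraticEisensteinDescentKatzWaldspurgerFrameCMInertBadFlatLZZRoad

/-! ### §1 The LZZ road at an additive prime, Manin-robust, for every `w_K` prime to `p` -/

section Rescale

variable {p : ℕ} [Fact p.Prime]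

/-- **LZZ 2018 Thm 1.5.1 ∧ 1.5.3 at `p² ∣ N` ⟹ the BDP display EXACTLY, Manin constant KEPT.** Verbatim
`…LZZRoad.exists_exactDisplay_of_thm151_thm153_additive` (virtual periods `Ω_K := 1`,
`Ω_p := (ι⁻¹(π²/4)·ϖ^{v_p N})^{1/4}`, constant `C = ι⁻¹(2π·ζ(2)·εp/(L(1,η)L(1,Π,Ad)))`, the kernel's `σ𝔭`) EXCEPT
that the binder `p ∤ c(Dt)` is dropped, `d_K < −4` is replaced by `p ∤ w_K` (`w_K = #𝓞_K^×`, so `K = ℚ(√−3)` is allowed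
at `p ≥ 5`), and the value reads `𝓛(𝟙)·C⁻¹ = u·(log_{ω_E} P / c)²` with the unit `u = ι⁻¹(8/(s·w_K²·√|d_K|))` (`p` odd,
`p ∤ w_K`, `p ∤ d_K`; `c = Dt.c ≠ 0` by `maninConstant_ne_zero_holds`). CONDITIONAL on the
named fact `hF` (statement-only, refereed source); nothing booked.
[cite: LiuZhangZhang2018, Thm 1.5.1, Remark 1.1.2, Thm 1.5.3 (Duke Math. J. 167 pp. 746–749)]
[cite: EdixhovenManin1991, §1 (the Manin constant is non-zero)] -/
theorem exists_exactDisplay_tors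
    (hF : thm151_thm153_modularCurve_heegnerVector_additive)
    (ι : PadicAlgCl p ≃+* ℂ) (W : WeierstrassCurve ℚ) [W.IsElliptic] [W.IsGloballyMinimal]
    (K : Type) [Field K] [NumberField K] (𝔭 : HeightOneSpectrum (𝓞 K))
    (κ : ZpExtension K p) (γ : absoluteGaloisGroup K) {N : ℕ} [NeZero N]
    (Dt : ModularParametrizationData W N) (H : HeegnerDatum N (NumberField.discr K))
    (ιK : K →+* ℂ) (e : K →+* ℚ_[p]) (P : (W.baseChange K).toAffine.Point)
    (f : CuspForm (CongruenceSubgroup.Gamma0 N) 2)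
    (hp2 : p ≠ 2) (hN : W.conductorNorm ℤ = N) (hp2N : p ^ 2 ∣ N) (hK : IsImaginaryQuadratic K)
    (hpw : ¬ p ∣ NumberField.Units.torsionOrder K)
    (hsplit : ((Ideal.span {(p : ℤ)}).primesOver (𝓞 K)).ncard = 2)
    (h𝔭 : ((p : ℕ) : 𝓞 K) ∈ 𝔭.asIdeal)
    (hι : ∀ (w' : InfinitePlace K) (k : 𝓞 K), k ∈ 𝔭.asIdeal ↔ ‖ι.symm (w'.embedding (k : K))‖ < 1)
    (hHN : SatisfiesHeegnerHypothesis N K) (hκ : κ.IsAnticyclotomic) (hγ : κ.IsTopGenerator γ)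
    (hfW : IsNewformOf W f)
    (hP : WeierstrassCurve.Affine.Point.map ιK.toRatAlgHom P = heegnerPointComplex Dt H)
    (he : ∀ k : 𝓞 K, k ∈ 𝔭.asIdeal ↔ ‖e (k : K)‖ < 1) :
    ∃ (Ωp : ℂ_[p]) (a : ℕ → ℂ_[p]) (C u : ℂ_[p]) (σ𝔭 : absoluteGaloisGroup K),
      Ωp ≠ 0 ∧ (∀ ρ : ℝ, 0 < ρ → ρ < 1 → ∃ B : ℝ, ∀ m : ℕ, ‖a m‖ * ρ ^ m ≤ B) ∧ C ≠ 0 ∧ ‖u‖ = 1 ∧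
      a 0 * C⁻¹ = u * (algebraMap ℚ_[p] ℂ_[p] (Castella2018.padicLogOmega W p e P / (Dt.c : ℚ_[p]))) ^ 2 ∧
      ∀ (φ : HeckeCharacter K) (n : ℕ) (r : FramedGaloisRep K (PadicAlgCl p) 1), 0 < n →
        (∀ v : HeightOneSpectrum (𝓞 K), φ.IsUnramifiedAt v) →
        φ.HasInfinityType (fun _ ↦ (n : ℤ)) (fun _ ↦ -(n : ℤ)) →
        IsPAdicAvatarOf ι φ r → FactorsThroughZp κ r →
        ∃ L : ℂ_[p], HasSum (fun m : ℕ ↦ a m * (avatarValueAt r γ - 1) ^ m) L ∧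
          ((ι.symm (bdpInterpolationValue p f 𝔭 φ n 1) : PadicAlgCl p) : ℂ_[p]) * Ωp ^ (4 * n) =
            L * C⁻¹ * (avatarValueAt r σ𝔭 ^ (N.factorization p))⁻¹ := by
  classical
  have hp : p.Prime := Fact.out
  have hpN : p ∣ N := dvd_trans (dvd_pow_self p two_ne_zero) hp2N
  -- §A the 𝔭-inducing embedding and its Heegner point
  obtain ⟨ιK₀, P₀, hιK₀, hP₀, hlog⟩ :=
    exists_inducing_embedding_and_heegnerPoint ι W K 𝔭 Dt H ιK e P hN hK hι hHN hP
  -- §B the fact at this datum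
  obtain ⟨a, Pet, Lad, s, εp, hrad, hPet, hLad, hs, hεp, hL1, hL2⟩ :=
    hF ι W K 𝔭 κ γ Dt H ιK₀ e P₀ f hN hp2N hK hsplit h𝔭 hι hιK₀ he hHN hκ hγ hfW hP₀
  -- §C the avatar clause from the kernel
  obtain ⟨ϖ, σ𝔭, hϖ, hav⟩ := PNewDisplay.exists_varpi_sigma_symm_heckeValueExtZero_eq ι hK hsplit h𝔭 κ
  -- the embedding `ι⁻¹ : ℂ → ℂ_p` as a ring map
  set em : ℂ →+* ℂ_[p] := (algebraMap (PadicAlgCl p) ℂ_[p]).comp ι.symm.toRingHom with hem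
  have hem' : ∀ z : ℂ, ((ι.symm z : PadicAlgCl p) : ℂ_[p]) = em z := fun z ↦ rfl
  have hemι : ∀ x : PadicAlgCl p, em (ι x) = (x : ℂ_[p]) := fun x ↦ by
    rw [← hem', RingEquiv.symm_apply_apply]
  -- `a_p(f) = 0` at the additive prime
  have hap : cuspCoeff f p = 0 := hfW.1.cuspCoeff_eq_zero_of_sq_dvd hp hp2N
  -- complex constants and their non-vanishing
  have hπ0 : (Real.pi : ℂ) ≠ 0 := by exact_mod_cast Real.pi_ne_zero
  set δs : ℂ := (Real.sqrt |(NumberField.discr K : ℝ)| : ℂ) with hδs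
  have hδs0 : δs ≠ 0 := by
    have hd : (0 : ℝ) < |(NumberField.discr K : ℝ)| :=
      abs_pos.mpr (by exact_mod_cast NumberField.discr_ne_zero K)
    rw [hδs, Ne, Complex.ofReal_eq_zero]
    exact (Real.sqrt_pos.mpr hd).ne'
  set z2 : ℂ := ((Real.pi ^ 2 / 6 : ℝ) : ℂ) with hz2
  have hz20 : z2 ≠ 0 := by
    rw [hz2]; push_cast
    exact div_ne_zero (pow_ne_zero _ hπ0) (by norm_num)
  set L1C : ℂ := ((imagQuadLOne K : ℝ) : ℂ) with hL1C
  have hL1C0 : L1C ≠ 0 := by rw [hL1C]; exact_mod_cast (imagQuadLOne_pos K).ne'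
  have hN0 : N ≠ 0 := NeZero.ne N
  have hψpos : (0 : ℝ) < dedekindPsi N :=
    mul_pos (by exact_mod_cast Nat.pos_of_ne_zero hN0) (Finset.prod_pos fun q _ ↦ by positivity)
  have hB : 0 < badFactor N Lad := badFactor_pos hLad
  have hLAdpos : 0 < adjointLOne N Pet Lad := div_pos (by unfold badFactor at hB; positivity) hψpos
  set LAC : ℂ := ((adjointLOne N Pet Lad : ℝ) : ℂ) with hLAC
  have hLAC0 : LAC ≠ 0 := by rw [hLAC]; exact_mod_cast hLAdpos.ne'
  have hs0 : (s : ℂ) ≠ 0 := by rcases hs with h | h <;> simp [h]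
  have hε0 : (εp : ℂ) ≠ 0 := by rcases hεp with h | h <;> simp [h]
  have hPet0 : (Pet : ℂ) ≠ 0 := by exact_mod_cast hPet.ne'
  have hB0 : ((badFactor N Lad : ℝ) : ℂ) ≠ 0 := by exact_mod_cast hB.ne'
  have hψ0 : ((dedekindPsi N : ℝ) : ℂ) ≠ 0 := by exact_mod_cast hψpos.ne'
  have hh0 : (NumberField.classNumber K : ℂ) ≠ 0 := by
    exact_mod_cast (NumberField.classNumber_pos (K := K)).ne'
  -- the Manin constant is non-zero (Edixhoven 1991 §1, tree theorem)
  have hcZ : Dt.c ≠ 0 := Dt.maninConstant_ne_zero_holds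
  have hcMC0 : ((Dt.c : ℤ) : ℂ) ≠ 0 := by exact_mod_cast hcZ
  -- `p`-adic constants: `ϖ`, the virtual period `λ = ι⁻¹(π²/4)·ϖ^{a}` and its fourth root
  set aN : ℕ := N.factorization p with haN
  set ϖ' : PadicAlgCl p := algebraMap ℚ_[p] (PadicAlgCl p) ϖ with hϖ'
  have hpQ : (p : ℚ_[p]) ≠ 0 := by exact_mod_cast hp.ne_zero
  have hϖ0 : ϖ ≠ 0 := by rcases hϖ with h | h <;> simp [h, hpQ]
  have hϖ'0 : ϖ' ≠ 0 := by
    rw [hϖ']; exact (map_ne_zero_iff _ (algebraMap ℚ_[p] (PadicAlgCl p)).injective).mpr hϖ0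
  set μ : PadicAlgCl p := ι.symm ((Real.pi : ℂ) ^ 2 / 2 ^ 2) with hμ
  have hμ0 : μ ≠ 0 := (map_ne_zero_iff _ ι.symm.injective).mpr
    (div_ne_zero (pow_ne_zero _ hπ0) (pow_ne_zero _ two_ne_zero))
  set lam : PadicAlgCl p := μ * ϖ' ^ aN with hlam
  have hlam0 : lam ≠ 0 := mul_ne_zero hμ0 (pow_ne_zero _ hϖ'0)
  obtain ⟨ω, hω⟩ := IsAlgClosed.exists_pow_nat_eq lam (by norm_num : 0 < 4)
  have hω0 : ω ≠ 0 := fun h0 ↦ hlam0 (by rw [← hω, h0]; norm_num)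
  have hωC0 : (ω : ℂ_[p]) ≠ 0 := by
    rw [← hemι]; exact (map_ne_zero em).mpr ((map_ne_zero_iff _ ι.injective).mpr hω0)
  -- the constant `c = 2π·ζ(2)·εp/(L(1,η)·L(1,Π,Ad))`
  set cC : ℂ := 2 * (Real.pi : ℂ) * z2 * (εp : ℂ) / (L1C * LAC) with hcC
  have hcC0 : cC ≠ 0 :=
    div_ne_zero (mul_ne_zero (mul_ne_zero (mul_ne_zero two_ne_zero hπ0) hz20) hε0) (mul_ne_zero hL1C0 hLAC0)
  -- `w_K` (prime to `p`), `p ∤ d_K`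
  set wC : ℂ := ((NumberField.Units.torsionOrder K : ℕ) : ℂ) with hwC
  have hw0 : wC ≠ 0 := by
    rw [hwC]; exact_mod_cast (NumberField.Units.torsionOrder_pos K).ne'
  have hdisc : ¬ (p : ℤ) ∣ NumberField.discr K :=
    Literature.SatisfiesHeegnerHypothesis.not_dvd_discr hK.1 hHN hp hpN
  -- the unit `u` (no Manin constant inside)
  set uC : ℂ := 8 / ((s : ℂ) * wC ^ 2 * δs) with huC
  set u : ℂ_[p] := em uC with hu
  have h2unit : ‖em (2 : ℂ)‖ = 1 := by
    rw [show (2 : ℂ) = ((2 : ℕ) : ℂ) by norm_num]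
    exact PNewDisplay.norm_map_natCast_eq_one em
      (fun h ↦ hp2 ((Nat.prime_dvd_prime_iff_eq hp Nat.prime_two).mp h))
  have h8 : ‖em (8 : ℂ)‖ = 1 := by
    rw [show (8 : ℂ) = 2 ^ 3 by norm_num, map_pow, norm_pow, h2unit, one_pow]
  have hs1 : ‖em (s : ℂ)‖ = 1 := by rcases hs with h | h <;> simp [h]
  have hw1 : ‖em wC‖ = 1 := by rw [hwC]; exact PNewDisplay.norm_map_natCast_eq_one em hpw
  have hδs1 : ‖em δs‖ = 1 := PNewDisplay.norm_map_sqrt_discr_eq_one em hdisc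
  have hu1 : ‖u‖ = 1 := by
    rw [hu, huC, map_div₀, norm_div, h8, map_mul, map_mul, norm_mul, norm_mul, hs1,
      map_pow, norm_pow, hw1, hδs1]
    norm_num
  have hcCne : em cC ≠ 0 := (map_ne_zero em).mpr hcC0
  -- the Manin constant read in `ℂ_p` along the two roads `ℤ → ℂ → ℂ_p` and `ℤ → ℚ_p → ℂ_p`
  have hcem : em ((Dt.c : ℤ) : ℂ) = (Dt.c : ℂ_[p]) := map_intCast em Dt.c
  have hcalg : algebraMap ℚ_[p] ℂ_[p] (Dt.c : ℚ_[p]) = (Dt.c : ℂ_[p]) := map_intCast _ Dt.c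
  have hcp0 : (Dt.c : ℂ_[p]) ≠ 0 := by exact_mod_cast hcZ
  have hvalue : u * (algebraMap ℚ_[p] ℂ_[p] (Castella2018.padicLogOmega W p e P / (Dt.c : ℚ_[p]))) ^ 2 =
      a 0 * (em cC)⁻¹ := by
    -- the value: `u·(log P / c)² = a 0 · c⁻¹` from (L2-add) and the printed identities
    set Lg : ℚ_[p] := Castella2018.padicLogOmega W p e P with hLg
    set αC : ℂ := ((heegnerVectorAlpha K N Dt.c Pet Lad s : ℝ) : ℂ) with hαC
    -- `α′ = 4·s·(6πc²Pet·w/(hψ))·B` and its non-vanishing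
    have hα4 : αC = 4 * (s : ℂ) * (6 * (Real.pi : ℂ) * ((Dt.c : ℤ) : ℂ) ^ 2 * (Pet : ℂ) * wC /
        ((NumberField.classNumber K : ℂ) * ((dedekindPsi N : ℝ) : ℂ)) * ((badFactor N Lad : ℝ) : ℂ)) := by
      rw [hαC, heegnerVectorAlpha_eq_four_mul K N Dt.c Pet Lad s
        (by exact_mod_cast (NumberField.classNumber_pos (K := K)).ne') hψpos.ne', hwC]
      push_cast
      ring
    have hαC0 : αC ≠ 0 := by
      rw [hα4]
      refine mul_ne_zero (mul_ne_zero (by norm_num) hs0)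
        (mul_ne_zero (div_ne_zero ?_ (mul_ne_zero hh0 hψ0)) hB0)
      exact mul_ne_zero (mul_ne_zero (mul_ne_zero (mul_ne_zero (by norm_num) hπ0) (pow_ne_zero _ hcMC0)) hPet0)
        hw0
    have hαem0 : em αC ≠ 0 := (map_ne_zero em).mpr hαC0
    -- the complex unit identity `uC · α′ · c = (2/h)²·εp·c_M²` and its image under `em`
    have hL1' : L1C = 2 * (Real.pi : ℂ) * (NumberField.classNumber K : ℂ) / (wC * δs) := by
      rw [hL1C, imagQuadLOne, hwC, hδs]; push_cast; ring
    have hLA' : LAC = 8 * (Real.pi : ℂ) ^ 3 * (Pet : ℂ) * ((badFactor N Lad : ℝ) : ℂ) /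
        ((dedekindPsi N : ℝ) : ℂ) := by
      rw [hLAC, adjointLOne]; push_cast; ring
    have hunitC : uC * (αC * cC) =
        (2 / (NumberField.classNumber K : ℂ)) ^ 2 * (εp : ℂ) * ((Dt.c : ℤ) : ℂ) ^ 2 := by
      rw [huC, hα4, hcC, hL1', hLA', hz2]
      push_cast
      exact manin_unit_identity (s : ℂ) ((Dt.c : ℤ) : ℂ) wC δs (NumberField.classNumber K : ℂ) (Pet : ℂ)
        ((badFactor N Lad : ℝ) : ℂ) ((dedekindPsi N : ℝ) : ℂ) (Real.pi : ℂ) (εp : ℂ) hs0 hw0 hδs0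
        hh0 hPet0 hB0 hψ0 hπ0 hε0
    have hunitP : u * (em αC * em cC) =
        em ((2 / (NumberField.classNumber K : ℂ)) ^ 2 * (εp : ℂ)) * (Dt.c : ℂ_[p]) ^ 2 := by
      rw [hu, ← map_mul em αC cC, ← map_mul em uC, hunitC, map_mul em, map_pow em, hcem]
    have hvSF : em (((valueSideFactorAdditive εp (NumberField.classNumber K) : ℚ)) : ℂ) =
        em ((2 / (NumberField.classNumber K : ℂ)) ^ 2 * (εp : ℂ)) := by
      congr 1
      rw [valueSideFactorAdditive]
      push_cast
      ring
    -- (L2-add) in `ℂ_p` atoms: `a 0 · em α′ = em((2/h)²εp) · (alg Lg)²`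
    have hL2' : a 0 * em αC = em ((2 / (NumberField.classNumber K : ℂ)) ^ 2 * (εp : ℂ)) *
        (algebraMap ℚ_[p] ℂ_[p] Lg) ^ 2 := by
      have h := hL2
      rw [hem', hem', ← map_pow, hlog, map_pow, hvSF] at h
      exact h
    -- conclude: `u·(alg (Lg/c))² = a 0 · c⁻¹`
    rw [map_div₀, hcalg]
    set E2 : ℂ_[p] := em ((2 / (NumberField.classNumber K : ℂ)) ^ 2 * (εp : ℂ)) with hE2
    set Lp : ℂ_[p] := algebraMap ℚ_[p] ℂ_[p] Lg with hLp
    have hkey : u * (Lp / (Dt.c : ℂ_[p])) ^ 2 * (em αC * em cC) = a 0 * em αC := by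
      rw [mul_right_comm, hunitP, hL2']
      field_simp
    calc u * (Lp / (Dt.c : ℂ_[p])) ^ 2
        = u * (Lp / (Dt.c : ℂ_[p])) ^ 2 * (em αC * em cC) * (em αC * em cC)⁻¹ := by
          rw [mul_inv_cancel_right₀ (mul_ne_zero hαem0 hcCne)]
      _ = a 0 * em αC * (em αC * em cC)⁻¹ := by rw [hkey]
      _ = a 0 * (em cC)⁻¹ := by
          rw [mul_inv, ← mul_assoc, mul_assoc (a 0), mul_inv_cancel₀ hαem0, mul_one]
  refine ⟨(ω : ℂ_[p]), a, em cC, u, σ𝔭, hωC0, hrad, hcCne, hu1, hvalue.symm, ?_⟩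
  intro φ n r hn hunr hinf havt hfac
  refine ⟨_, hL1 φ n r hn hunr hinf havt hfac, ?_⟩
  -- the per-character identity: display = 𝓛(χ) · c⁻¹ · (r(σ𝔭)^{a})⁻¹
  obtain ⟨m, hm⟩ := Nat.exists_eq_add_one_of_ne_zero hn.ne'
  set dP : PadicAlgCl p := ((Matrix.GeneralLinearGroup.det (r σ𝔭) : (PadicAlgCl p)ˣ) :
    PadicAlgCl p) with hdP
  have hdP0 : dP ≠ 0 := Units.ne_zero _
  have havP : avatarValueAt r σ𝔭 = (dP : ℂ_[p]) := rfl
  -- (AV-p) read in `ℂ`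
  have hAV := hav φ n r hn hunr hinf havt hfac
  rw [hm] at hAV
  have hφ𝔭 : heckeValueExtZero φ 𝔭 = ι ϖ' ^ (m + 1) * ι dP := by
    rw [← map_pow, ← map_mul, ← hAV, RingEquiv.apply_symm_apply]
  -- `Ω⁴` read in `ℂ`
  have hOm : ι ω ^ 4 = (Real.pi : ℂ) ^ 2 / 2 ^ 2 * ι ϖ' ^ aN := by
    rw [← map_pow, hω, hlam, map_mul, map_pow, hμ, RingEquiv.apply_symm_apply]
  have hιdP : ι dP ≠ 0 := (map_ne_zero_iff _ ι.injective).mpr hdP0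
  have hιϖ : ι ϖ' ≠ 0 := (map_ne_zero_iff _ ι.injective).mpr hϖ'0
  have hΓ1 : Complex.Gamma ((m + 1 : ℕ) : ℂ) = (Nat.factorial m : ℂ) := by
    rw [Nat.cast_succ, Complex.Gamma_nat_eq_factorial]
  have hΓ2 : Complex.Gamma (((m + 1 : ℕ) : ℂ) + 1) = (Nat.factorial (m + 1) : ℂ) := by
    exact_mod_cast Complex.Gamma_nat_eq_factorial (m + 1)
  have key := additive_display_term_identity (Nat.factorial (m + 1) : ℂ) (Nat.factorial m : ℂ)
    (rankinSelbergValueHecke f φ 1) (Real.pi : ℂ) z2 L1C LAC (εp : ℂ) (heckeValueExtZero φ 𝔭)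
    (ι dP) (ι ϖ') (ι ω) ((p : ℂ))⁻¹ 2 m aN hπ0 hz20 hL1C0 hLAC0 hε0 hιdP hιϖ two_ne_zero hOm hφ𝔭
  -- rewrite the goal as `em` of the complex identity
  simp only [hm]
  rw [hem', hem', havP, ← hemι ω, ← hemι dP, bdpInterpolationValue_of_dvd hpN, hap, hΓ1, hΓ2,
    ← map_pow em, ← map_pow em, ← map_mul em]
  rw [show interpolationValueAdditive εp aN f 𝔭 φ (m + 1) (imagQuadLOne K) (adjointLOne N Pet Lad) =
    ((Nat.factorial (m + 1) : ℂ) * (Nat.factorial m : ℂ) / (2 * (Real.pi : ℂ)) ^ (2 * (m + 1) - 1)) * z2 *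
      rankinSelbergValueHecke f φ 1 / (2 * L1C * LAC) * (2 * (Real.pi : ℂ) ^ (2 * (m + 1) - 1)) *
      ((εp : ℂ) * heckeValueExtZero φ 𝔭 ^ aN) by
    simp only [interpolationValueAdditive, waldspurgerPeriodRatio, archFactor, additiveEpsilonOverLSq,
      hz2, hL1C, hLAC, Nat.add_sub_cancel]
    push_cast
    ring]
  rw [key, hcC]
  simp only [map_mul, map_inv₀, map_pow]

/-- **The continuous display, Manin-robust** (the limit form of `exists_exactDisplay_tors`): with the virtual
periods `Ω_K := 1`, `Ω_p` and the unit `u` of `exists_exactDisplay_tors`, Castella's display tends to `u·(log_{ω_E} P / c)²` along EVERY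
interpolation sequence through `κ` with `r_k(γ) → 1` (open-disc continuity of `𝓛|_Γ` at `ρ = 1/2`,
`X2.tendsto_value_of_tendsto_zero_of_coeff_bound`; uniform avatar convergence,
`X2.PNewDisplay.eventually_forall_norm_avatarValueAt_sub_one_lt`). CONDITIONAL on `hF`; nothing booked.
[cite: LiuZhangZhang2018, Thm 1.5.1, Remark 1.1.2, Thm 1.5.3 (Duke Math. J. 167 pp. 746–749)]
[cite: Washington1997, §7.1 (power series on the open unit disc)] -/
theorem exists_continuousDisplay_tors
    (hF : thm151_thm153_modularCurve_heegnerVector_additive)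
    (ι : PadicAlgCl p ≃+* ℂ) (W : WeierstrassCurve ℚ) [W.IsElliptic] [W.IsGloballyMinimal]
    (K : Type) [Field K] [NumberField K] (𝔭 : HeightOneSpectrum (𝓞 K))
    (κ : ZpExtension K p) (γ : absoluteGaloisGroup K) {N : ℕ} [NeZero N]
    (Dt : ModularParametrizationData W N) (H : HeegnerDatum N (NumberField.discr K))
    (ιK : K →+* ℂ) (e : K →+* ℚ_[p]) (P : (W.baseChange K).toAffine.Point)
    (f : CuspForm (CongruenceSubgroup.Gamma0 N) 2)
    (hp2 : p ≠ 2) (hN : W.conductorNorm ℤ = N) (hp2N : p ^ 2 ∣ N) (hK : IsImaginaryQuadratic K)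
    (hpw : ¬ p ∣ NumberField.Units.torsionOrder K)
    (hsplit : ((Ideal.span {(p : ℤ)}).primesOver (𝓞 K)).ncard = 2)
    (h𝔭 : ((p : ℕ) : 𝓞 K) ∈ 𝔭.asIdeal)
    (hι : ∀ (w' : InfinitePlace K) (k : 𝓞 K), k ∈ 𝔭.asIdeal ↔ ‖ι.symm (w'.embedding (k : K))‖ < 1)
    (hHN : SatisfiesHeegnerHypothesis N K) (hκ : κ.IsAnticyclotomic) (hγ : κ.IsTopGenerator γ)
    (hfW : IsNewformOf W f)
    (hP : WeierstrassCurve.Affine.Point.map ιK.toRatAlgHom P = heegnerPointComplex Dt H)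
    (he : ∀ k : 𝓞 K, k ∈ 𝔭.asIdeal ↔ ‖e (k : K)‖ < 1) :
    ∃ (Ωp u : ℂ_[p]), Ωp ≠ 0 ∧ ‖u‖ = 1 ∧
      ∀ (φ : ℕ → HeckeCharacter K) (n : ℕ → ℕ) (r : ℕ → FramedGaloisRep K (PadicAlgCl p) 1),
        (∀ k, 0 < n k) → (∀ k (v : HeightOneSpectrum (𝓞 K)), (φ k).IsUnramifiedAt v) →
        (∀ k, (φ k).HasInfinityType (fun _ ↦ (n k : ℤ)) (fun _ ↦ -(n k : ℤ))) →
        (∀ k, IsPAdicAvatarOf ι (φ k) (r k)) → (∀ k, FactorsThroughZp κ (r k)) →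
        Tendsto (fun k ↦ avatarValueAt (r k) γ) atTop (𝓝 1) →
        Tendsto (fun k ↦ ((ι.symm (bdpInterpolationValue p f 𝔭 (φ k) (n k) 1) :
          PadicAlgCl p) : ℂ_[p]) * Ωp ^ (4 * n k)) atTop
          (𝓝 (u * (algebraMap ℚ_[p] ℂ_[p] (Castella2018.padicLogOmega W p e P / (Dt.c : ℚ_[p]))) ^ 2)) := by
  obtain ⟨Ωp, a, C, u, σ𝔭, hΩp, hrad, hC, hu, hval, hdisp⟩ :=
    exists_exactDisplay_tors hF ι W K 𝔭 κ γ Dt H ιK e P f hp2 hN hp2N hK hpw hsplit h𝔭 hι hHN hκ hγ hfW hP he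
  refine ⟨Ωp, u, hΩp, hu, ?_⟩
  intro φ n r hn hunr hinf havt hfac hlimγ
  choose L hL hdL using fun k ↦ hdisp (φ k) (n k) (r k) (hn k) (hunr k) (hinf k) (havt k) (hfac k)
  have hσ : ∀ σ : absoluteGaloisGroup K, Tendsto (fun k ↦ avatarValueAt (r k) σ) atTop (𝓝 1) := by
    intro σ
    rw [Metric.tendsto_nhds]
    intro ε hε
    filter_upwards [PNewDisplay.eventually_forall_norm_avatarValueAt_sub_one_lt hγ hfac hlimγ hε] with k hk
    rw [dist_eq_norm]
    exact hk σ
  obtain ⟨B, hB⟩ := hrad (1 / 2) (by norm_num) (by norm_num)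
  have hx : Tendsto (fun k ↦ avatarValueAt (r k) γ - 1) atTop (𝓝 0) := by
    have h := hlimγ.sub_const 1
    rwa [sub_self] at h
  have hlimL : Tendsto L atTop (𝓝 (a 0)) :=
    tendsto_value_of_tendsto_zero_of_coeff_bound (ρ := 1 / 2) (by norm_num) hB hx hL
  have hlim : Tendsto (fun k ↦ L k * C⁻¹ * (avatarValueAt (r k) σ𝔭 ^ (N.factorization p))⁻¹) atTop
      (𝓝 (a 0 * C⁻¹ * ((1 : ℂ_[p]) ^ (N.factorization p))⁻¹)) :=
    (hlimL.mul tendsto_const_nhds).mul (((hσ σ𝔭).pow _).inv₀ (by simp))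
  rw [show (fun k ↦ ((ι.symm (bdpInterpolationValue p f 𝔭 (φ k) (n k) 1) : PadicAlgCl p) : ℂ_[p]) *
      Ωp ^ (4 * n k)) = (fun k ↦ L k * C⁻¹ * (avatarValueAt (r k) σ𝔭 ^ (N.factorization p))⁻¹) from
    funext hdL]
  simpa only [one_pow, inv_one, mul_one, hval] using hlim

end Rescale

end Summit.BirchSwinnertonDyer.BirchSwinnertonDyer.Theorems.UniversalToricDescentWaldspurgerFlat

end
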